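import Literature.RingTheory.CohomologyAnnihilator.Localization
import Summits.ResolutionOfSingularities.ResolutionOfSingularities.Theorems.HomologicalConductorPersistenceFaithfullyFlatDescentCompletion
import HarnessLib

/-!
# Stratum descent for the cohomology annihilator (`caⁿ(R) ∋ r ⇒ caⁿ(C) ∋ c` along a localisation
# followed by a faithfully flat extension)

Crux `HomologicalConductor.NoZenoR` (stmt-ResolutionOfSingularities-19943), chain W4.4, kill probe K4.4g
«KC-Nash» (support level, counted 0): res-L0-w44-plan-1 RULING (ρ12b) 10:02:39Z = res-L0-w44-idea-2's
round-7 OFFER, file (1) of 2 — `L/res-L0-w44-idea-2/Sketch-idea-2-r7.lean` 3ed17969ad69852f §R7.1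
VERBATIM (names re-homed under `…Theorems.NoZeno.SandwichCluster.StratumDescent`; consulting author in
idea-2's stead: res-L0-w44-tri-2). `[OURS · L W4.4]` — the composite of two landed facts, NOT a
statement of the manuscript under review in cell res-hironaka and using none of its statements;
AI-written, weaker than expert review.

The two ingredients (both in the tree): Iyengar–Takahashi Lemma 2.10(1)
(`Literature.RingTheory.CohomologyAnnihilator.map_cohomologyAnnihilatorOfDegree_le_of_isLocalization`:
`caⁿ(R)·R_𝔮 ⊆ caⁿ(R_𝔮)`) and faithfully flat descent of `caⁿ`
(`…PersistenceFaithfullyFlatDescentCompletion.comap_cohomologyAnnihilatorOfDegree_le_of_faithfullyFlat`: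
`caⁿ(S) ∩ T ⊆ caⁿ(T)` for `T → S` faithfully flat, p512917's file). Composite («stratum descent»,
memo `DESCENT-KC.md` §1 of idea-2): if `R → R_𝔮` is a localisation of a noetherian ring, `C → R_𝔮` is
faithfully flat with `C` noetherian, and `r ↦ v·c` with `v` a unit of `R_𝔮`, then

* `mem_cohomologyAnnihilatorOfDegree_of_descent` — `r ∈ caⁿ(R) ⇒ c ∈ caⁿ(C)` (same level `n`);
* `not_mem_cohomologyAnnihilatorOfDegree_of_descent` — the exclusion form: `c ∉ caⁿ(C) ⇒ r ∉ caⁿ(R)`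
  (an exclusion certified on the small transversal ring is an exclusion on `R`, at the SAME level);
* `mem_cohomologyAnnihilator_of_descent`, `not_mem_cohomologyAnnihilator_of_descent` — the level-free
  forms for `ca = ⋃ₙ caⁿ`.

Use (idea-2, memo §1): `R = k[S][t]_𝔪` a toric cylinder point, `𝔮 = 𝔮_F` the generic point of the
stratum of a face `F`, `C = C_F` the transversal cylinder point (or `V_F`, the transversal vertex),
`v = χ^{m₀}` a monomial unit of the big torus factor — this makes the «7/23 T-A rows excluded at all
levels» of `DESCENT-KC.md` (K4.4g) citable by name together with vertex certificates such as the
sibling file (2) `Theorems/Globalisation/Negative/G1VertexCertificate.lean`.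
-/

-- single-problem summit: the doubled namespace component is forced
set_option linter.dupNamespace false
set_option autoImplicit false

open Literature.RingTheory.CohomologyAnnihilator

universe u

namespace Summit.ResolutionOfSingularities.ResolutionOfSingularities.Theorems.NoZeno.SandwichCluster.StratumDescent

section descent

variable {R Rq C : Type u} [CommRing R] [CommRing Rq] [CommRing C] [Algebra R Rq] [Algebra C Rq]

open Summit.ResolutionOfSingularities.ResolutionOfSingularities.Theorems.HomologicalConductor.PersistenceFaithfullyFlatDescentCompletion
  (comap_cohomologyAnnihilatorOfDegree_le_of_faithfullyFlat)

/-- **Stratum descent for `caⁿ`.**  `R → Rq` a localisation of a noetherian ring, `C → Rq`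
faithfully flat with `C` noetherian, `algebraMap R Rq r = v * algebraMap C Rq c` with `v` a unit:
`r ∈ caⁿ(R) ⇒ c ∈ caⁿ(C)`.  [cite: IyengarTakahashi2014, Lemma 2.10(1)] + [folklore: faithfully
flat descent, tree `comap_cohomologyAnnihilatorOfDegree_le_of_faithfullyFlat`] -/
theorem mem_cohomologyAnnihilatorOfDegree_of_descent (U : Submonoid R) [IsLocalization U Rq] [IsNoetherianRing R]
    [IsNoetherianRing C] [Module.FaithfullyFlat C Rq] (n : ℕ) {r : R} {c : C} (v : Rqˣ)
    (h : algebraMap R Rq r = (v : Rq) * algebraMap C Rq c)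
    (hr : r ∈ cohomologyAnnihilatorOfDegree R n) :
    c ∈ cohomologyAnnihilatorOfDegree C n := by
  have h1 : algebraMap R Rq r ∈ cohomologyAnnihilatorOfDegree Rq n :=
    map_cohomologyAnnihilatorOfDegree_le_of_isLocalization U Rq n (Ideal.mem_map_of_mem _ hr)
  have h2 : algebraMap C Rq c ∈ cohomologyAnnihilatorOfDegree Rq n := by
    have hv : ((v⁻¹ : Rqˣ) : Rq) * algebraMap R Rq r = algebraMap C Rq c := by
      rw [h, ← mul_assoc, Units.inv_mul, one_mul]
    rw [← hv]
    exact Ideal.mul_mem_left _ _ h1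
  exact comap_cohomologyAnnihilatorOfDegree_le_of_faithfullyFlat (T := C) (S := Rq) n
    (Ideal.mem_comap.mpr h2)

/-- **Stratum descent, exclusion form** (the one used in `DESCENT-KC.md`): an exclusion
`c ∉ caⁿ(C)` certified on the transversal ring is an exclusion `r ∉ caⁿ(R)` at the same level.
[cite: IyengarTakahashi2014, Lemma 2.10(1)] -/
theorem not_mem_cohomologyAnnihilatorOfDegree_of_descent (U : Submonoid R) [IsLocalization U Rq] [IsNoetherianRing R]
    [IsNoetherianRing C] [Module.FaithfullyFlat C Rq] (n : ℕ) {r : R} {c : C} (v : Rqˣ)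
    (h : algebraMap R Rq r = (v : Rq) * algebraMap C Rq c)
    (hc : c ∉ cohomologyAnnihilatorOfDegree C n) :
    r ∉ cohomologyAnnihilatorOfDegree R n :=
  fun hr => hc (mem_cohomologyAnnihilatorOfDegree_of_descent U n v h hr)

/-- **Stratum descent for `ca = ⋃ₙ caⁿ`.** [cite: IyengarTakahashi2014, Lemma 2.10(1)] -/
theorem mem_cohomologyAnnihilator_of_descent (U : Submonoid R) [IsLocalization U Rq] [IsNoetherianRing R]
    [IsNoetherianRing C] [Module.FaithfullyFlat C Rq] {r : R} {c : C} (v : Rqˣ)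
    (h : algebraMap R Rq r = (v : Rq) * algebraMap C Rq c)
    (hr : r ∈ cohomologyAnnihilator R) : c ∈ cohomologyAnnihilator C := by
  rw [mem_cohomologyAnnihilator_iff] at hr ⊢
  obtain ⟨n, hn⟩ := hr
  exact ⟨n, mem_cohomologyAnnihilatorOfDegree_of_descent U n v h hn⟩

/-- **All-level exclusion form**: `c ∉ ca(C)` (i.e. `c ∉ caⁿ(C)` for every `n`) gives
`r ∉ ca(R)`. [cite: IyengarTakahashi2014, Lemma 2.10(1)] -/
theorem not_mem_cohomologyAnnihilator_of_descent (U : Submonoid R) [IsLocalization U Rq] [IsNoetherianRing R]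
    [IsNoetherianRing C] [Module.FaithfullyFlat C Rq] {r : R} {c : C} (v : Rqˣ)
    (h : algebraMap R Rq r = (v : Rq) * algebraMap C Rq c)
    (hc : c ∉ cohomologyAnnihilator C) : r ∉ cohomologyAnnihilator R :=
  fun hr => hc (mem_cohomologyAnnihilator_of_descent U v h hr)

end descent

end Summit.ResolutionOfSingularities.ResolutionOfSingularities.Theorems.NoZeno.SandwichCluster.StratumDescent
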